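import Summits.CriticalPhenomena.PercolationContinuityZ3.Theorems.Transplant.PlanarSkeletonFrmFromDefs
import Summits.CriticalPhenomena.PercolationContinuityZ3.Theorems.Transplant.SkelFrmFromBChoiceRootRunY
import Summits.CriticalPhenomena.PercolationContinuityZ3.Theorems.Transplant.SkelFrmBChoiceRootRunY
import HarnessLib
import Summits.CriticalPhenomena.PercolationContinuityZ3.Theorems.Transplant.SkelFrmBChoiceRootBoxY2
/-!
# U-WAVE PORT (RULING D-U, lead g21 2026-08-26; WAVE-U-MANIFEST v3.0 row «SkelFrmBChoiceRootBoxY2» ↦ «SkelFrmFromBChoiceRootBoxY2») of the tree module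
# `Transplant/SkelFrmBChoiceRootBoxY2` onto the carrier `PlanarSkeletonFrmFrom` (frames only, cylinders connected from width `ℓ₀` on)

ORIGINAL TITLE: N2 (frames-only node `SamePDropOfSkeletonFrm₁`, OPEN), (R) column SECOND axis — **THE ROOT y′-ARRIVAL BOX AGAINST (C)'s, ALONG BOTTOM**:

builds on p205010 (kernel theorem, internal audit signed; external expert review pending) — nothing in this file uses p205010; NOTHING is claimed about the
OPEN node U `SamePDropOfSkeletonFrmFrom₁` (nor U_s / the end state).  Lane `prim-bschramm`, seat `prim-hp-8 gen 53 (U-wave port pen, family P-hp8; tool of record = p3-g26 port_u.py)`; helper file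
(`--supports stmt-CriticalPhenomena-4575 --as helper`).  PORT RULES r1–r4 of RULING D-U: declaration order and proof texts are those of the original,
byte-identical except (i) the carrier token `PlanarSkeletonFrm ↦ PlanarSkeletonFrmFrom` (binders, `namespace`/`end` lines, qualified names of twinned
declarations), (ii) carrier-FREE declarations of the original (φ-level `Skelφ…` blocks and namespace-only arithmetic residents) are NOT re-declared —
this file imports the original and `export`s the twin-free residents (POLICY T / treatment (m1)); residents whose statement mentions a twinned
constant are copied, (iii) every carrier-binding declaration keeps its explicit binder `(Φ : PlanarSkeletonFrmFrom G)` in its own signature (r2).  Docstrings and citations are the original's.  Manifest row idx 145 (level 17; flags verbatim|MIXED(m1)); filed by the hp-8 lineage under RULING M-11 (family P-hp8).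
-/

noncomputable section

open scoped Classical

namespace Summit.CriticalPhenomena.PercolationContinuityZ3.Theorems.Transplant

namespace Skelφ

open Literature.Probability.Percolation Literature.Probability.LatticeModels SimpleGraph

section M2

variable {n ℓ : ℕ} {hs v : ℤ} {R' ρ q W q' W' : ℕ}

end M2

end Skelφ

namespace PlanarSkeletonFrmFrom

namespace NegB

open Literature.Probability.Percolation Literature.Probability.LatticeModels SimpleGraph
open SkelConc (Consts)
open Skelφ (shearUnit kgSL kgSLY KGYRows kgXY kgTY kgM₁Y kgM₂Y kgDec₁Y kgDec₂Y)
open Neg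

namespace KS

section BoxY2

variable (κ : Consts) {V : Type} [DecidableEq V] [Countable V] {G : SimpleGraph V} [G.LocallyFinite] (Φ : PlanarSkeletonFrmFrom G) (t : V) (p : unitInterval)
  (D : Skelφ.StepI.DataNS V) (mk g f qxY WxY : ℕ)

/-- **`0 ≤ m₁Y^C − m₁Y^R ≤ 274`** at `N = kgNYv0` (`dec₁Y·Δm₁ ≤ 2·X2R + dec₁Y − 1`, `2·X2R ≤ 137·n_L − 1`, `2·dec₁Y ≥ n_L + 2`). [this work] -/
theorem dm₁Y_R_le (κ : Consts) {V : Type} [DecidableEq V] [Countable V] {G : SimpleGraph V} [G.LocallyFinite] (Φ : PlanarSkeletonFrmFrom G) (t : V) (p : unitInterval) (D : Skelφ.StepI.DataNS V) (mk : ℕ) (g : ℕ) (f : ℕ) (qxY : ℕ) (WxY : ℕ) (hN : EqNumL κ Φ t p D g f) (hg : gFloorKG κ Φ t p D mk ≤ g) (hg2 : 40 * Neg.K κ * KS0.R'0 κ Φ t p D mk ≤ g)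
    (hf : KS.fxR0 κ Φ t p D mk ≤ f) (hWxY : KS.Rs t D mk + 34 * nL κ Φ t p D g f + 29 * KS0.R'0 κ Φ t p D mk + 2 ≤ WxY) (hWx : WxY ≤ 100 * nL κ Φ t p D g f) :
    0 ≤ ((((kgM₁Y (nL κ Φ t p D g f) (vL κ Φ t p D g f) (kgR κ Φ t p D mk) 0 (kgWY κ Φ t p D g f WxY) (kgNYv0 κ Φ t p D g f mk qxY WxY))) : ℕ) : ℤ) - ((((kgM₁Y (nL κ Φ t p D g f) (vL κ Φ t p D g f) (kgR κ Φ t p D mk) 0 (kgWY κ Φ t p D g f (KS.WxYR κ Φ t p D mk g f WxY)) (kgNYv0 κ Φ t p D g f mk qxY WxY))) : ℕ) : ℤ) ∧ ((((kgM₁Y (nL κ Φ t p D g f) (vL κ Φ t p D g f) (kgR κ Φ t p D mk) 0 (kgWY κ Φ t p D g f WxY) (kgNYv0 κ Φ t p D g f mk qxY WxY))) : ℕ) : ℤ) - ((((kgM₁Y (nL κ Φ t p D g f) (vL κ Φ t p D g f) (kgR κ Φ t p D mk) 0 (kgWY κ Φ t p D g f (KS.WxYR κ Φ t p D mk g f WxY))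 (kgNYv0 κ Φ t p D g f mk qxY WxY))) : ℕ) : ℤ) ≤ 274 := by
  have HC := (kgYRows0_of κ Φ t p D g f mk qxY WxY hN hg)
  have HR := (kgYRows0_of κ Φ t p D g f mk qxY (KS.WxYR κ Φ t p D mk g f WxY) hN hg)
  have hm := HR.kgM₁Y_sub_mul_le HC (kgNYv0 κ Φ t p D g f mk qxY WxY)
  have hmono := HR.kgM₁Y_monoW (kgWY_R_le κ Φ t p D mk g f WxY) (kgNYv0 κ Φ t p D g f mk qxY WxY)
  have hmono' : ((((kgM₁Y (nL κ Φ t p D g f) (vL κ Φ t p D g f) (kgR κ Φ t p D mk) 0 (kgWY κ Φ t p D g f (KS.WxYR κ Φ t p D mk g f WxY)) (kgNYv0 κ Φ t p D g f mk qxY WxY))) : ℕ) : ℤ) ≤ ((((kgM₁Y (nL κ Φ t p D g f) (vL κ Φ t p D g f) (kgR κ Φ t p D mk) 0 (kgWY κ Φ t p D g f WxY) (kgNYv0 κ Φ t p D g f mk qxY WxY))) : ℕ) : ℤ) := by exact_mod_cast hmono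
  obtain ⟨-, hsum⟩ := X2R_add_WxYR κ Φ t p D mk g f WxY hWxY
  obtain ⟨hKR, -, -, hR1, hK, -⟩ := valsQ_floor κ Φ t p D g f mk hN hg hg2
  have eR : (kgR κ Φ t p D mk) = (KS0.R'0 κ Φ t p D mk) := rfl
  have hX2 : 2 * (((KS.X2R κ Φ t p D mk g f WxY) : ℕ) : ℤ) ≤ (WxY : ℤ) + (KS.Rs t D mk : ℕ) + 34 * (nL κ Φ t p D g f : ℤ) + 29 * (((KS0.R'0 κ Φ t p D mk) : ℕ) : ℤ) + 2 := by
    have : 2 * (KS.X2R κ Φ t p D mk g f WxY) ≤ WxY + KS.Rs t D mk + 34 * (nL κ Φ t p D g f) + 29 * (KS0.R'0 κ Φ t p D mk) + 2 := by unfold KS.X2R; omega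
    exact_mod_cast this
  have hRs : ((KS.Rs t D mk : ℕ) : ℤ) + 1 ≤ (nL κ Φ t p D g f : ℤ) := by
    have hfn := hf.trans (n₁L_le_nL κ Φ t p D g f).2
    rw [KS.fxR0_eq] at hfn
    have : KS.Rs t D mk + 1 ≤ (nL κ Φ t p D g f) := by omega
    exact_mod_cast this
  have hWx' : ((WxY : ℕ) : ℤ) ≤ 100 * (nL κ Φ t p D g f : ℤ) := by exact_mod_cast hWx
  have h1600 : 1600 * (((KS0.R'0 κ Φ t p D mk) : ℕ) : ℤ) + 1 ≤ (nL κ Φ t p D g f : ℤ) := by nlinarith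
  have hd : (kgDec₁Y (nL κ Φ t p D g f) (kgR κ Φ t p D mk) 0) = (nL κ Φ t p D g f : ℤ) - 2 * (((kgR κ Φ t p D mk) : ℕ) : ℤ) - ((0 : ℕ) : ℤ) := rfl
  rw [hd, eR] at hm
  push_cast at hm hsum
  have hΔeq : ((((kgM₁Y (nL κ Φ t p D g f) (vL κ Φ t p D g f) (KS0.R'0 κ Φ t p D mk) 0 (kgWY κ Φ t p D g f WxY) (kgNYv0 κ Φ t p D g f mk qxY WxY))) : ℕ) : ℤ) - ((((kgM₁Y (nL κ Φ t p D g f) (vL κ Φ t p D g f) (KS0.R'0 κ Φ t p D mk) 0 (kgWY κ Φ t p D g f (KS.WxYR κ Φ t p D mk g f WxY)) (kgNYv0 κ Φ t p D g f mk qxY WxY))) : ℕ) : ℤ) ≤ 274 := by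
    have hpos : 0 < (nL κ Φ t p D g f : ℤ) - 2 * (((KS0.R'0 κ Φ t p D mk) : ℕ) : ℤ) := by linarith
    have hlt : ((nL κ Φ t p D g f : ℤ) - 2 * (((KS0.R'0 κ Φ t p D mk) : ℕ) : ℤ)) * ((((((kgM₁Y (nL κ Φ t p D g f) (vL κ Φ t p D g f) (KS0.R'0 κ Φ t p D mk) 0 (kgWY κ Φ t p D g f WxY) (kgNYv0 κ Φ t p D g f mk qxY WxY))) : ℕ) : ℤ) - ((((kgM₁Y (nL κ Φ t p D g f) (vL κ Φ t p D g f) (KS0.R'0 κ Φ t p D mk) 0 (kgWY κ Φ t p D g f (KS.WxYR κ Φ t p D mk g f WxY)) (kgNYv0 κ Φ t p D g f mk qxY WxY))) : ℕ) : ℤ)) - 1) <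
        ((nL κ Φ t p D g f : ℤ) - 2 * (((KS0.R'0 κ Φ t p D mk) : ℕ) : ℤ)) * 274 := by nlinarith
    have := lt_of_mul_lt_mul_left hlt hpos.le
    linarith
  exact ⟨by linarith, hΔeq⟩

/-- **`XY^C − XY^R ≤ 275·R′0 ≤ sL`** at `N = kgNYv0` (`Δm₁Y ≤ 274`, `Δm₂Y ≤ 1` because `2·274·R′0 < dec₂Y`). [this work] -/
theorem XY_sub_R_le (κ : Consts) {V : Type} [DecidableEq V] [Countable V] {G : SimpleGraph V} [G.LocallyFinite] (Φ : PlanarSkeletonFrmFrom G) (t : V) (p : unitInterval) (D : Skelφ.StepI.DataNS V) (mk : ℕ) (g : ℕ) (f : ℕ) (qxY : ℕ) (WxY : ℕ) (hN : EqNumL κ Φ t p D g f) (hg : gFloorKG κ Φ t p D mk ≤ g) (hg2 : 40 * Neg.K κ * KS0.R'0 κ Φ t p D mk ≤ g)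
    (hf : KS.fxR0 κ Φ t p D mk ≤ f) (hWxY : KS.Rs t D mk + 34 * nL κ Φ t p D g f + 29 * KS0.R'0 κ Φ t p D mk + 2 ≤ WxY) (hWx : WxY ≤ 100 * nL κ Φ t p D g f) :
    0 ≤ (kgXY (nL κ Φ t p D g f) (ℓL κ Φ t p D g f) (hL κ Φ t p D g f) (vL κ Φ t p D g f) (kgR κ Φ t p D mk) 0 (kgqY κ Φ t p D g f qxY) (kgWY κ Φ t p D g f WxY) (kgNYv0 κ Φ t p D g f mk qxY WxY)) - (kgXY (nL κ Φ t p D g f) (ℓL κ Φ t p D g f) (hL κ Φ t p D g f) (vL κ Φ t p D g f) (kgR κ Φ t p D mk) 0 (kgqY κ Φ t p D g f qxY) (kgWY κ Φ t p D g f (KS.WxYR κ Φ t p D mk g f WxY)) (kgNYv0 κ Φ t p D g f mk qxY WxY)) ∧ (kgXY (nL κ Φ t p D g f) (ℓL κ Φ t p D g f) (hL κ Φ t p D g f) (vL κ Φ t p D g f) (kgR κ Φ t p D mk) 0 (kgqY κ Φ t p D g f qxY) (kgWY κ Φ t p D g f WxY) (kgNYv0 κ Φ t p D g f mk qxY WxY))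 - (kgXY (nL κ Φ t p D g f) (ℓL κ Φ t p D g f) (hL κ Φ t p D g f) (vL κ Φ t p D g f) (kgR κ Φ t p D mk) 0 (kgqY κ Φ t p D g f qxY) (kgWY κ Φ t p D g f (KS.WxYR κ Φ t p D mk g f WxY)) (kgNYv0 κ Φ t p D g f mk qxY WxY)) ≤ (kgSL (nL κ Φ t p D g f) (ℓL κ Φ t p D g f) (hL κ Φ t p D g f)) := by
  have HC := (kgYRows0_of κ Φ t p D g f mk qxY WxY hN hg)
  have HR := (kgYRows0_of κ Φ t p D g f mk qxY (KS.WxYR κ Φ t p D mk g f WxY) hN hg)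
  obtain ⟨hΔ0, hΔ⟩ := dm₁Y_R_le κ Φ t p D mk g f qxY WxY hN hg hg2 hf hWxY hWx
  have hm2 := HR.kgM₂Y_sub_mul_le HC le_rfl (kgWY_R_le κ Φ t p D mk g f WxY) (kgNYv0 κ Φ t p D g f mk qxY WxY)
  have hm2mono := HR.kgM₂Y_mono_qW le_rfl (kgWY_R_le κ Φ t p D mk g f WxY) (kgNYv0 κ Φ t p D g f mk qxY WxY)
  have hm2mono' : ((((kgM₂Y (nL κ Φ t p D g f) (ℓL κ Φ t p D g f) (hL κ Φ t p D g f) (vL κ Φ t p D g f) (kgR κ Φ t p D mk) 0 (kgqY κ Φ t p D g f qxY) (kgWY κ Φ t p D g f (KS.WxYR κ Φ t p D mk g f WxY)) (kgNYv0 κ Φ t p D g f mk qxY WxY))) : ℕ) : ℤ) ≤ ((((kgM₂Y (nL κ Φ t p D g f) (ℓL κ Φ t p D g f) (hL κ Φ t p D g f) (vL κ Φ t p D g f) (kgR κ Φ t p D mk) 0 (kgqY κ Φ t p D g f qxY) (kgWY κ Φ t p D g f WxY) (kgNYv0 κ Φ t p D g f mk qxY WxY))) : ℕ) : ℤ) :=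 by exact_mod_cast hm2mono
  obtain ⟨hKR, hKs, h958, hR1, hK, -⟩ := valsQ_floor κ Φ t p D g f mk hN hg hg2
  have hd2 : (kgDec₂Y (nL κ Φ t p D g f) (ℓL κ Φ t p D g f) (hL κ Φ t p D g f) (kgR κ Φ t p D mk) 0) = kgSLY (nL κ Φ t p D g f) (ℓL κ Φ t p D g f) (hL κ Φ t p D g f) - 2 * (((kgR κ Φ t p D mk) : ℕ) : ℤ) - ((0 : ℕ) : ℤ) := rfl
  have eσ : kgSLY (nL κ Φ t p D g f) (ℓL κ Φ t p D g f) (hL κ Φ t p D g f) = (kgSL (nL κ Φ t p D g f) (ℓL κ Φ t p D g f) (hL κ Φ t p D g f)) := rfl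
  have hR0 : (0 : ℤ) ≤ (((kgR κ Φ t p D mk) : ℕ) : ℤ) := by positivity
  have h1600s : 1600 * (((kgR κ Φ t p D mk) : ℕ) : ℤ) ≤ (kgSL (nL κ Φ t p D g f) (ℓL κ Φ t p D g f) (hL κ Φ t p D g f)) + 1 := by
    have : 1600 * (((KS0.R'0 κ Φ t p D mk) : ℕ) : ℤ) ≤ (kgSL (nL κ Φ t p D g f) (ℓL κ Φ t p D g f) (hL κ Φ t p D g f)) + 1 := by nlinarith
    exact this
  -- TY^C − TY^R = 2·Δm₁·(R + 0)
  have eT : (kgTY (nL κ Φ t p D g f) (ℓL κ Φ t p D g f) (hL κ Φ t p D g f) (vL κ Φ t p D g f) (kgR κ Φ t p D mk) 0 (kgqY κ Φ t p D g f qxY) (kgWY κ Φ t p D g f WxY) (kgNYv0 κ Φ t p D g f mk qxY WxY)) - (kgTY (nL κ Φ t p D g f) (ℓL κ Φ t p D g f) (hL κ Φ t p D g f) (vL κ Φ t p D g f) (kgR κ Φ t p D mk) 0 (kgqY κ Φ t p D g f qxY) (kgWY κ Φ t p D g f (KS.WxYR κ Φ t p D mk g f WxY)) (kgNYv0 κ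 Φ t p D g f mk qxY WxY)) = 2 * (((((kgM₁Y (nL κ Φ t p D g f) (vL κ Φ t p D g f) (kgR κ Φ t p D mk) 0 (kgWY κ Φ t p D g f WxY) (kgNYv0 κ Φ t p D g f mk qxY WxY))) : ℕ) : ℤ) - ((((kgM₁Y (nL κ Φ t p D g f) (vL κ Φ t p D g f) (kgR κ Φ t p D mk) 0 (kgWY κ Φ t p D g f (KS.WxYR κ Φ t p D mk g f WxY)) (kgNYv0 κ Φ t p D g f mk qxY WxY))) : ℕ) : ℤ)) * ((((kgR κ Φ t p D mk) : ℕ) : ℤ) + ((0 : ℕ) : ℤ)) := by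
    unfold kgTY; ring
  -- XY^C − XY^R = (Δm₁ + Δm₂)·(R + 0)
  have eX : (kgXY (nL κ Φ t p D g f) (ℓL κ Φ t p D g f) (hL κ Φ t p D g f) (vL κ Φ t p D g f) (kgR κ Φ t p D mk) 0 (kgqY κ Φ t p D g f qxY) (kgWY κ Φ t p D g f WxY) (kgNYv0 κ Φ t p D g f mk qxY WxY)) - (kgXY (nL κ Φ t p D g f) (ℓL κ Φ t p D g f) (hL κ Φ t p D g f) (vL κ Φ t p D g f) (kgR κ Φ t p D mk) 0 (kgqY κ Φ t p D g f qxY) (kgWY κ Φ t p D g f (KS.WxYR κ Φ t p D mk g f WxY)) (kgNYv0 κ Φ t p D g f mk qxY WxY)) = ((((((kgM₁Y (nL κ Φ t p D g f) (vL κ Φ t p D g f) (kgR κ Φ t p D mk) 0 (kgWY κ Φ t p D g f WxY) (kgNYv0 κ Φ t p D g f mk qxY WxY))) : ℕ) : ℤ) - ((((kgM₁Y (nL κ Φ t p D g f) (vL κ Φ t p D g f) (kgR κ Φ t p D mk) 0 (kgWY κ Φ t p D g f (KS.WxYR κ Φ t p D mk g f WxY)) (kgNYv0 κ Φ t p D g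 f mk qxY WxY))) : ℕ) : ℤ)) +
      (((((kgM₂Y (nL κ Φ t p D g f) (ℓL κ Φ t p D g f) (hL κ Φ t p D g f) (vL κ Φ t p D g f) (kgR κ Φ t p D mk) 0 (kgqY κ Φ t p D g f qxY) (kgWY κ Φ t p D g f WxY) (kgNYv0 κ Φ t p D g f mk qxY WxY))) : ℕ) : ℤ) - ((((kgM₂Y (nL κ Φ t p D g f) (ℓL κ Φ t p D g f) (hL κ Φ t p D g f) (vL κ Φ t p D g f) (kgR κ Φ t p D mk) 0 (kgqY κ Φ t p D g f qxY) (kgWY κ Φ t p D g f (KS.WxYR κ Φ t p D mk g f WxY)) (kgNYv0 κ Φ t p D g f mk qxY WxY))) : ℕ) : ℤ))) * ((((kgR κ Φ t p D mk) : ℕ) : ℤ) + ((0 : ℕ) : ℤ)) := by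
    unfold kgXY; ring
  rw [hd2, eσ, eT] at hm2
  push_cast at hm2
  set Δ₁ := ((((kgM₁Y (nL κ Φ t p D g f) (vL κ Φ t p D g f) (kgR κ Φ t p D mk) 0 (kgWY κ Φ t p D g f WxY) (kgNYv0 κ Φ t p D g f mk qxY WxY))) : ℕ) : ℤ) - ((((kgM₁Y (nL κ Φ t p D g f) (vL κ Φ t p D g f) (kgR κ Φ t p D mk) 0 (kgWY κ Φ t p D g f (KS.WxYR κ Φ t p D mk g f WxY)) (kgNYv0 κ Φ t p D g f mk qxY WxY))) : ℕ) : ℤ) with hΔ₁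
  set Δ₂ := ((((kgM₂Y (nL κ Φ t p D g f) (ℓL κ Φ t p D g f) (hL κ Φ t p D g f) (vL κ Φ t p D g f) (kgR κ Φ t p D mk) 0 (kgqY κ Φ t p D g f qxY) (kgWY κ Φ t p D g f WxY) (kgNYv0 κ Φ t p D g f mk qxY WxY))) : ℕ) : ℤ) - ((((kgM₂Y (nL κ Φ t p D g f) (ℓL κ Φ t p D g f) (hL κ Φ t p D g f) (vL κ Φ t p D g f) (kgR κ Φ t p D mk) 0 (kgqY κ Φ t p D g f qxY) (kgWY κ Φ t p D g f (KS.WxYR κ Φ t p D mk g f WxY)) (kgNYv0 κ Φ t p D g f mk qxY WxY))) : ℕ) : ℤ) with hΔ₂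
  have hΔ₂0 : 0 ≤ Δ₂ := by linarith
  have hm2' : ((kgSL (nL κ Φ t p D g f) (ℓL κ Φ t p D g f) (hL κ Φ t p D g f)) - 2 * (((kgR κ Φ t p D mk) : ℕ) : ℤ)) * Δ₂ ≤ 2 * Δ₁ * (((kgR κ Φ t p D mk) : ℕ) : ℤ) + ((kgSL (nL κ Φ t p D g f) (ℓL κ Φ t p D g f) (hL κ Φ t p D g f)) - 2 * (((kgR κ Φ t p D mk) : ℕ) : ℤ)) - 1 := by
    rw [hΔ₁, hΔ₂]; linarith
  have hprod : 2 * Δ₁ * (((kgR κ Φ t p D mk) : ℕ) : ℤ) ≤ 548 * (((kgR κ Φ t p D mk) : ℕ) : ℤ) := by nlinarith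
  have hpos : 0 < (kgSL (nL κ Φ t p D g f) (ℓL κ Φ t p D g f) (hL κ Φ t p D g f)) - 2 * (((kgR κ Φ t p D mk) : ℕ) : ℤ) := by linarith
  have hΔ₂1 : Δ₂ ≤ 1 := by
    have hlt : ((kgSL (nL κ Φ t p D g f) (ℓL κ Φ t p D g f) (hL κ Φ t p D g f)) - 2 * (((kgR κ Φ t p D mk) : ℕ) : ℤ)) * Δ₂ < ((kgSL (nL κ Φ t p D g f) (ℓL κ Φ t p D g f) (hL κ Φ t p D g f)) - 2 * (((kgR κ Φ t p D mk) : ℕ) : ℤ)) * 2 := by linarith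
    have := lt_of_mul_lt_mul_left hlt hpos.le
    linarith
  have hA : (Δ₁ + Δ₂) * (((kgR κ Φ t p D mk) : ℕ) : ℤ) ≤ 275 * (((kgR κ Φ t p D mk) : ℕ) : ℤ) := mul_le_mul_of_nonneg_right (by linarith) hR0
  have hB : 0 ≤ (Δ₁ + Δ₂) * (((kgR κ Φ t p D mk) : ℕ) : ℤ) := mul_nonneg (by linarith) hR0
  rw [eX]
  simp only [Nat.cast_zero, add_zero]
  exact ⟨hB, by linarith⟩

/-- **ALONG BOTTOM**: `arrLo₁^C − sL ≤ lo₁^R` for the root's y′-arrival box (`lo₁ = (N+1)·sL + XY − (P − 1)`, `XY^C − XY^R ≤ sL`). [this work] -/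
theorem rootBoxY_bottom_R (κ : Consts) {V : Type} [DecidableEq V] [Countable V] {G : SimpleGraph V} [G.LocallyFinite] (Φ : PlanarSkeletonFrmFrom G) (t : V) (p : unitInterval) (D : Skelφ.StepI.DataNS V) (mk : ℕ) (g : ℕ) (f : ℕ) (qxY : ℕ) (WxY : ℕ) (hN : EqNumL κ Φ t p D g f) (hg : gFloorKG κ Φ t p D mk ≤ g) (hg2 : 40 * Neg.K κ * KS0.R'0 κ Φ t p D mk ≤ g)
    (hf : KS.fxR0 κ Φ t p D mk ≤ f) (hWxY : KS.Rs t D mk + 34 * nL κ Φ t p D g f + 29 * KS0.R'0 κ Φ t p D mk + 2 ≤ WxY) (hWx : WxY ≤ 100 * nL κ Φ t p D g f) :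
    ((kgYRows0_of κ Φ t p D g f mk qxY WxY hN hg).kgLastLoY (kgNYv0 κ Φ t p D g f mk qxY WxY)) 1 - (kgSL (nL κ Φ t p D g f) (ℓL κ Φ t p D g f) (hL κ Φ t p D g f)) ≤ ((kgYRows0_of κ Φ t p D g f mk qxY (KS.WxYR κ Φ t p D mk g f WxY) hN hg).kgLastLoY (kgNYv0 κ Φ t p D g f mk qxY WxY)) 1 := by
  obtain ⟨-, hX⟩ := XY_sub_R_le κ Φ t p D mk g f qxY WxY hN hg hg2 hf hWxY hWx
  simp only [KGYRows.kgLastLoY, Matrix.cons_val_one, Matrix.cons_val_zero]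
  linarith

end BoxY2

end KS

end NegB

end PlanarSkeletonFrmFrom

end Summit.CriticalPhenomena.PercolationContinuityZ3.Theorems.Transplant

end
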